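import Summits.RiemannHypothesis.RiemannHypothesis.Theorems.WeilTwoPrimeDeflM77YBase
import Summits.RiemannHypothesis.RiemannHypothesis.Theorems.WeilTwoPrimeDeflM77YDataR
import Literature.NumberTheory.LFunctions.WeilTwoPrimeCellsT120
import Literature.NumberTheory.LFunctions.WeilTwoPrimeCertificateDeflated
import HarnessLib

/-!
# Deflated two-prime certificate M77Y: the certificate `weilCertDeflM77Y : WeilCert23` and its augmented coefficient matrix

`weilCertDeflM77Y` = base `weilCertDeflM77YBase` + `j = 5` + `pnu = 64` + the cells `weilTwoPrimeCellsT120` + support `b = 77/100` + the table `weilCertDeflM77YNu`; penalty data `weilCertDeflM77YR`; `weilCertDeflM77YP = P_r + Σ μ ĉ ĉᵀ`. [cite: Yoshida1992, §6, Thm 1 p. 310] Data only.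
-/

noncomputable section

namespace Summit.RiemannHypothesis.RiemannHypothesis.Theorems.EvenWinsBeyondArch

open Literature.NumberTheory.LFunctions

/-- **The deflated two-prime certificate M77Y** (`a₀ = b = 77/100`, `N = 255`, `T = 120`, `β₂₃ = 17/25`, k_odd = 6). [folklore] -/
def weilCertDeflM77Y : WeilCert23 := ⟨weilCertDeflM77YBase, 5, 64, weilTwoPrimeCellsT120, 77/100, weilCertDeflM77YNu⟩

/-- The base of `weilCertDeflM77Y` is `weilCertDeflM77YBase` (definitional). [folklore] -/
theorem weilCertDeflM77Y_base : weilCertDeflM77Y.base = weilCertDeflM77YBase := rfl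

/-- The table of `weilCertDeflM77Y` is `weilCertDeflM77YNu` (definitional). [folklore] -/
theorem weilCertDeflM77Y_nuTab : weilCertDeflM77Y.nuTab = weilCertDeflM77YNu := rfl

/-- The augmented coefficient matrix `P_r + Σ μ ĉ ĉᵀ` of certificate M77Y. [folklore] -/
def weilCertDeflM77YP (k l : ℕ) : ℚ := weilCertDeflM77YBase.prQ weilCertDeflM77YNu k l + rankOneQ weilCertDeflM77YR k l

/-- `weilCertDeflM77YP` is the augmented matrix of the certificate (definitional). [folklore] -/
theorem weilCertDeflM77YP_eq : weilCertDeflM77YP = fun k l ↦ weilCertDeflM77Y.base.prQ weilCertDeflM77Y.nuTab k l + rankOneQ weilCertDeflM77YR k l := rfl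

end Summit.RiemannHypothesis.RiemannHypothesis.Theorems.EvenWinsBeyondArch
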